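import Literature.Computability.AlgebraicComplexity.GKSS19Thm5HittingSets
import Literature.Computability.Complexity.CodeFPRat
import Literature.Computability.Complexity.CodeFPLists
import Literature.Computability.Complexity.CodeFPListKit
import Literature.Computability.Complexity.CodeFPBudgets
import Literature.Computability.Complexity.CodeFPFinite
import HarnessLib

/-!
# GKSS19 ‹Thm 5› (constant `k`), explicitness half and the discharge `GKSS2019_thm_5_holds`

Guo–Kumar–Saptharishi–Solomon, *Derandomization from algebraic hardness* (arXiv:1905.00091),
‹Thm 5› (arXiv p0005.txt:L28-31): "Let `k ∈ ℕ` and `δ > 0` be arbitrary constants. Suppose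
`{P_{k,d}}` is an explicit family of `k`-variate polynomials such that `deg(P_{k,d}) = d` and `P_{k,d}`
requires circuits of size at least `d^δ`. Then, there are explicit hitting sets of size
`poly_{δ,k}(s)` for the class `𝒞(s, s, s)`."  Explicitness (§1.2, p0006.txt:L28): the hitting sets
"can be enumerated by a deterministic Turing machine in time `poly(s)`" given that `P_d` is
output "as a sum of monomials" in time `poly(d)` (Question 4, footnote).

`GKSS19Thm5HittingSets.lean` constructs the family `hitList P t E s₀ s` (the grid image of the
generator `G_{Q(s)}` of the split polynomial `Q(s) = Q_{k,d(s),t}`, resp. the trivial grid below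
`s₀`) and proves that it hits `𝒞(s,s,s)` and has size `≤ s^C + C`. This file proves that it is
EXPLICIT — a polynomial-time string function maps `1^s` to `encodePoints (hitList … s)` — by
assembling a functional program from the tree's typed `CodeFP` combinators (no machine written):
* `mulLin`, `linProd`, `factors`, `natCoeffs` (coefficients of `∏_w (a_w + b_w T)^{⦅e⦆_w}` over `ℕ`
  by repeated multiplication with linear factors), `valQ` (`Δ_j(Q)(a,b)` as the rational sum
  `Σ_{(e, c) ∈ denseList P_d} c · coeff_j`), `rowM`, `mainM`, `hitM` — the program;
* `valQ_eq` : the program computes `Δ_j(Q(s))` at the grid point (`eval_sumElim_delta`,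
  `aeval_kron`), hence `hitM_eq_hitList`;
* `hitM_codeFP` : the program is `CodeFP unE (listE (listE encodeRat))`, i.e. an `FP` string
  function maps `1^s` to `encodePoints (hitList … s)` (`isExplicitPoints_hitList`);
* `GKSS2019_thm_5_holds : GKSS2019_thm_5` — the discharge (with `GKSS2019_mainThm_holds`,
  `isGeneratorFor_Qof`, `hitList_hits`, `length_hitList_le`).

Theorems + definitions with bodies; no named facts. HONEST FRAMING: a formalization of a
published 2019 theorem over `ℚ`; nothing here bears on VP ≠ VNP.

## References
* [GuoKumarSaptharishiSolomon2019] arXiv:1905.00091, Thm 5 (p.5 L28-31), §1.2 (p.6 L28),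
  proof of Thm 25 (p.13 L10-36).
* [AroraBarak2009] S. Arora, B. Barak, Computational Complexity, §1.3 (closure of polynomial time
  under composition and polynomially bounded loops).
-/

noncomputable section

namespace Literature.Computability.AlgebraicComplexity

namespace GKSS2019

open Literature.Barriers.ValiantsHypothesis HittingSets Literature.Computability.Complexity
open Literature.Computability.Complexity.CodeFP
open Literature.Algebra.EuclideanLattices (encodeRat)

/-! ### The program (semantic level) -/

section Program

/-- Multiply the coefficient list `c` (low degree first) by the linear factor `a + b·T`.
[cite: GuoKumarSaptharishiSolomon2019, §1.2 (arXiv p0006.txt:L28, poly(s)-time enumeration)] -/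
def mulLin (a b : ℕ) (c : List ℕ) : List ℕ :=
  List.zipWith (· + ·) (c.map (a * ·) ++ [0]) (0 :: c.map (b * ·))

/-- Coefficient list of `∏_{(a,b) ∈ F} (a + b·T)`. [cite: GuoKumarSaptharishiSolomon2019, §1.2 (arXiv p0006.txt:L28)] -/
def linProd (F : List (ℕ × ℕ)) : List ℕ :=
  F.foldl (fun c ab => mulLin ab.1 ab.2 c) [1]

/-- The linear factors of `∏_w (a_w + b_w T)^{⦅e⦆_w}` at the grid list `l` (`a = l[0..m)`,
`b = l[m..2m)`, variable `w = z_{v,i}` with `v = w / t`, `i = w % t`), each repeated digit-many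
times. [cite: GuoKumarSaptharishiSolomon2019, proof of Thm 25 (arXiv p0013.txt:L14-17)] -/
def factors (t B m : ℕ) (e l : List ℕ) : List (ℕ × ℕ) :=
  ((List.range m).map fun w =>
    List.replicate (digit B (w % t) (e.getD (w / t) 0)) (l.getD w 0, l.getD (m + w) 0)).flatten

/-- The coefficients of `∏_w (a_w + b_w T)^{⦅e⦆_w} ∈ ℕ[T]`. [cite: GuoKumarSaptharishiSolomon2019, proof of Thm 25 (arXiv p0013.txt:L14-17)] -/
def natCoeffs (t B m : ℕ) (e l : List ℕ) : List ℕ := linProd (factors t B m e l)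

/-- `Δ_j(Q)(a, b)` computed from the dense monomial list of `P_d`:
`Σ_{(e, num/den)} (num/den) · coeff_j ∏_w (a_w + b_w T)^{⦅e⦆_w}`. [cite: GuoKumarSaptharishiSolomon2019, Def 9 and proof of Thm 25 (arXiv p0006.txt:L44-48, p0013.txt:L14-17)] -/
def valQ (t B m : ℕ) (L : List (List ℕ × (ℤ × ℕ))) (l : List ℕ) (j : ℕ) : ℚ :=
  (L.map fun mono : List ℕ × (ℤ × ℕ) =>
    ((mono.2.1 : ℚ) / (mono.2.2 : ℚ)) * ((natCoeffs t B m mono.1 l).getD j 0 : ℕ)).sum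

/-- The point of the hitting set at the grid list `l` (program form of `row`). [cite: GuoKumarSaptharishiSolomon2019, §3.2 (arXiv p0013.txt:L24-27)] -/
def rowM (t B m : ℕ) (L : List (List ℕ × (ℤ × ℕ))) (s : ℕ) (l : List ℕ) : List ℚ :=
  (List.range s).map (valQ t B m L l)

end Program

/-! ### Correctness of the program: coefficient lists are polynomials -/

section Correctness

open Polynomial

/-- The polynomial with a given coefficient list. [folklore] -/
def toPoly (c : List ℕ) : ℕ[X] :=
  ∑ i ∈ Finset.range c.length, C (c.getD i 0) * X ^ i

/-- Coefficients of `toPoly`. [folklore] -/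
private theorem coeff_toPoly (c : List ℕ) (j : ℕ) : (toPoly c).coeff j = c.getD j 0 := by
  rw [toPoly, finsetSum_coeff]
  simp_rw [coeff_C_mul_X_pow]
  rw [Finset.sum_ite_eq]
  split_ifs with h
  · rfl
  · rw [List.getD_eq_default]
    simpa using h

/-- Entries of `mulLin`. [folklore] -/
private theorem getD_mulLin (a b : ℕ) (c : List ℕ) (j : ℕ) :
    (mulLin a b c).getD j 0 = a * c.getD j 0 + (if j = 0 then 0 else b * c.getD (j - 1) 0) := by
  unfold mulLin
  by_cases hj : j < c.length + 1
  · have h1 : (c.map (a * ·) ++ [0])[j]? = some (a * c.getD j 0) := by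
      by_cases hj' : j < c.length
      · rw [List.getElem?_append_left (by simpa using hj'), List.getElem?_map,
          List.getD_eq_getElem?_getD, (List.getElem?_eq_getElem hj')]
        rfl
      · have hje : j = c.length := by omega
        subst hje
        rw [List.getElem?_append_right (by simp), List.length_map, Nat.sub_self,
          List.getD_eq_default _ _ le_rfl]
        simp
    have h2 : (0 :: c.map (b * ·))[j]? = some (if j = 0 then 0 else b * c.getD (j - 1) 0) := by
      rcases j with _ | j
      · simp
      · rw [List.getElem?_cons_succ, List.getElem?_map, if_neg (Nat.succ_ne_zero j),
          Nat.succ_sub_one, List.getD_eq_getElem?_getD, List.getElem?_eq_getElem (by omega)]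
        rfl
    rw [List.getD_eq_getElem?_getD, List.getElem?_zipWith, h1, h2]
    rfl
  · have hc1 : c.getD j 0 = 0 := List.getD_eq_default _ _ (by omega)
    have hc2 : c.getD (j - 1) 0 = 0 := List.getD_eq_default _ _ (by omega)
    rw [List.getD_eq_default _ _ (by simp [List.length_zipWith]; omega), hc1, hc2]
    simp

/-- `toPoly (mulLin a b c) = (a + bT) · toPoly c`. [folklore] -/
private theorem toPoly_mulLin (a b : ℕ) (c : List ℕ) :
    toPoly (mulLin a b c) = (C a + C b * X) * toPoly c := by
  ext j
  rw [coeff_toPoly, getD_mulLin, add_mul, coeff_add, coeff_C_mul, coeff_toPoly, mul_assoc,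
    coeff_C_mul]
  congr 1
  rcases j with _ | j
  · simp
  · rw [if_neg (Nat.succ_ne_zero j), coeff_X_mul, coeff_toPoly, Nat.succ_sub_one]

/-- `toPoly (linProd F) = ∏_{(a,b) ∈ F} (a + bT)`. [folklore] -/
private theorem toPoly_linProd (F : List (ℕ × ℕ)) :
    toPoly (linProd F) = (F.map fun ab : ℕ × ℕ => C ab.1 + C ab.2 * X).prod := by
  suffices h : ∀ c₀ : List ℕ, toPoly (F.foldl (fun c ab => mulLin ab.1 ab.2 c) c₀) =
      (F.map fun ab : ℕ × ℕ => C ab.1 + C ab.2 * X).prod * toPoly c₀ by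
    rw [linProd, h]
    have h1 : toPoly [1] = 1 := by simp [toPoly]
    rw [h1, mul_one]
  induction F with
  | nil => intro c₀; simp
  | cons f F ih =>
    intro c₀
    rw [List.foldl_cons, ih, toPoly_mulLin, List.map_cons, List.prod_cons]
    ring

/-- Products over `List.range` are products over `Finset.range`. [folklore] -/
private theorem prod_map_range {M : Type*} [CommMonoid M] (f : ℕ → M) (n : ℕ) :
    ((List.range n).map f).prod = ∏ i ∈ Finset.range n, f i := by
  induction n with
  | zero => simp
  | succ n ih => rw [List.range_succ, List.map_append, List.prod_append, ih,
      Finset.prod_range_succ]; simp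

/-- **The coefficient program computes `∏_w (a_w + b_w T)^{⦅e⦆_w}`** (over `ℕ`, variables
`w < m` read as `(v, i) = (w / t, w % t)`). [cite: GuoKumarSaptharishiSolomon2019, proof of Thm 25 (arXiv p0013.txt:L14-17)] -/
theorem toPoly_natCoeffs (t B m : ℕ) (e l : List ℕ) :
    toPoly (natCoeffs t B m e l) = ∏ w ∈ Finset.range m,
      (C (l.getD w 0) + C (l.getD (m + w) 0) * X) ^ digit B (w % t) (e.getD (w / t) 0) := by
  rw [natCoeffs, toPoly_linProd, factors, List.map_flatten, List.prod_flatten, List.map_map,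
    ← prod_map_range]
  congr 1
  rw [List.map_map]
  refine List.map_congr_left fun w _ => ?_
  simp [List.map_replicate, List.prod_replicate]

variable {k : ℕ}

/-- The exponent `⦅e⦆_w` read from the exponent LIST of `e` at `(v, i) = (w / t, w % t)`.
[cite: GuoKumarSaptharishiSolomon2019, proof of Thm 25 (arXiv p0013.txt:L14-17)] -/
theorem splitExp_eq_digit_getD (t B : ℕ) (e : Fin k →₀ ℕ) (w : Fin (k * t)) :
    splitExp t B e w = digit B ((w : ℕ) % t) ((List.ofFn fun i : Fin k => e i).getD ((w : ℕ) / t) 0) := by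
  rw [splitExp_apply, zi, zv]
  have hv : ((finProdFinEquiv.symm w).1 : ℕ) = (w : ℕ) / t := by simp [finProdFinEquiv]
  have hi : ((finProdFinEquiv.symm w).2 : ℕ) = (w : ℕ) % t := by simp [finProdFinEquiv]
  have hlt : (w : ℕ) / t < k := by rw [← hv]; exact (finProdFinEquiv.symm w).1.isLt
  rw [hi, List.getD_eq_getElem?_getD, List.getElem?_ofFn]
  simp only [hlt, ↓reduceDIte, Option.getD_some]
  rfl

/-- The `ℚ`-product of the line substitution at a grid point is the cast of the `ℕ`-product.
[cite: GuoKumarSaptharishiSolomon2019, proof of Thm 25 (arXiv p0013.txt:L14-17)] -/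
theorem prod_lineSubst_natPt (t B : ℕ) (e : Fin k →₀ ℕ) (l : List ℕ) :
    (∏ w : Fin (k * t), lineSubst (fun v : Fin (k * t) => ((l.getD v 0 : ℕ) : ℚ))
        (fun v : Fin (k * t) => ((l.getD (k * t + v) 0 : ℕ) : ℚ)) w ^ splitExp t B e w) =
      Polynomial.map (Nat.castRingHom ℚ)
        (toPoly (natCoeffs t B (k * t) (List.ofFn fun i : Fin k => e i) l)) := by
  rw [toPoly_natCoeffs, Polynomial.map_prod,
    ← Fin.prod_univ_eq_prod_range (fun w => Polynomial.map (Nat.castRingHom ℚ)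
      ((C (l.getD w 0) + C (l.getD (k * t + w) 0) * X) ^
        digit B (w % t) ((List.ofFn fun i : Fin k => e i).getD (w / t) 0))) (k * t)]
  refine Finset.prod_congr rfl fun w _ => ?_
  rw [Polynomial.map_pow, Polynomial.map_add, Polynomial.map_mul, map_C, map_C, map_X,
    splitExp_eq_digit_getD]
  simp [lineSubst]

/-- `denseList` enumerates the support once: sums over it are sums over the support.
[cite: GuoKumarSaptharishiSolomon2019, Question 4 footnote (arXiv p0005.txt:L2 "as a sum of monomials")] -/
theorem sum_denseList (P : MvPolynomial (Fin k) ℚ) (g : List ℕ × (ℤ × ℕ) → ℚ) :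
    ((denseList P).map g).sum =
      ∑ e ∈ P.support, g (List.ofFn (fun i : Fin k => e i),
        ((MvPolynomial.coeff e P).num, (MvPolynomial.coeff e P).den)) := by
  classical
  have hget : ∀ (e : Fin k →₀ ℕ) (i : Fin k), (List.ofFn fun i : Fin k => e i).getD i.val 0 = e i :=
    fun e i => by
      rw [List.getD_eq_getElem?_getD, List.getElem?_ofFn]
      simp [i.isLt]
  rw [denseList, List.map_map, ← List.sum_toFinset _ (Finset.sort_nodup _ _), Finset.sort_toFinset,
    Finset.sum_image fun e₁ _ e₂ _ h => ?_]
  · refine Finset.sum_congr rfl fun e _ => ?_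
    have he : (Finsupp.equivFunOnFinite.symm fun i : Fin k =>
        (List.ofFn fun i : Fin k => e i).getD i.val 0) = e := by
      ext i; simp
    dsimp only [Function.comp_apply]
    rw [he]
  · ext i
    have := congrArg (fun L : List ℕ => L.getD i.val 0) h
    simpa only [hget] using this

/-- **The program computes `Δ_j(Q)` at the grid point**: for `Q = Q_{k,d,t}` in base `B` built from
`P` and the monomial list `denseList P`, `valQ … l j = Δ_j(Q)(natPt l)`.
[cite: GuoKumarSaptharishiSolomon2019, Def 9 and proof of Thm 25 (arXiv p0006.txt:L44-48, p0013.txt:L14-17)] -/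
theorem valQ_eq (t B : ℕ) (P : MvPolynomial (Fin k) ℚ) (l : List ℕ) (j : ℕ) :
    valQ t B (k * t) (denseList P) l j =
      MvPolynomial.eval (natPt (k * t) l) (delta (kron t B P) j) := by
  have hpt : natPt (k * t) l = Sum.elim (fun v : Fin (k * t) => ((l.getD v 0 : ℕ) : ℚ))
      (fun v : Fin (k * t) => ((l.getD (k * t + v) 0 : ℕ) : ℚ)) := rfl
  rw [hpt, eval_sumElim_delta, aeval_kron, finsetSum_coeff, valQ, sum_denseList]
  refine Finset.sum_congr rfl fun e _ => ?_
  dsimp only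
  rw [Polynomial.algebraMap_eq, coeff_C_mul, prod_lineSubst_natPt, coeff_map, coeff_toPoly]
  simp [Rat.num_div_den]

/-- Program form of `row`. [cite: GuoKumarSaptharishiSolomon2019, §3.2 (arXiv p0013.txt:L24-27)] -/
theorem rowM_eq (t B : ℕ) (P : MvPolynomial (Fin k) ℚ) (s : ℕ) (l : List ℕ) :
    rowM t B (k * t) (denseList P) s l = row (kron t B P) s l := by
  unfold rowM row
  exact List.map_congr_left fun j _ => valQ_eq t B P l j

end Correctness

/-! ### The program on codes, I: linear products (`mulLin`, `linProd`) -/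

section CodeLin

open _root_.Computability

/-- Length of `mulLin`. [folklore] -/
private theorem length_mulLin (a b : ℕ) (c : List ℕ) : (mulLin a b c).length = c.length + 1 := by
  simp [mulLin, List.length_zipWith]

/-- Default-reading a bounded list. [folklore] -/
private theorem getD_le_of_forall_le {c : List ℕ} {M : ℕ} (hc : ∀ x ∈ c, x ≤ M) (j : ℕ) :
    c.getD j 0 ≤ M := by
  by_cases hj : j < c.length
  · rw [List.getD_eq_getElem _ _ hj]; exact hc _ (List.getElem_mem hj)
  · rw [List.getD_eq_default _ _ (not_lt.mp hj)]; exact Nat.zero_le _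

/-- Entries of `mulLin a b c` are at most `(a + b) · max c`. [folklore] -/
private theorem le_of_mem_mulLin {a b : ℕ} {c : List ℕ} {M : ℕ} (hc : ∀ x ∈ c, x ≤ M) :
    ∀ y ∈ mulLin a b c, y ≤ (a + b) * M := by
  intro y hy
  obtain ⟨j, hj, rfl⟩ := List.mem_iff_getElem.mp hy
  rw [← List.getD_eq_getElem _ 0 hj, getD_mulLin]
  have h1 := getD_le_of_forall_le hc j
  have h2 := getD_le_of_forall_le hc (j - 1)
  split_ifs
  · nlinarith
  · nlinarith

/-- The running product: length and entry bound along the fold. [folklore] -/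
private theorem foldl_mulLin_bound (l₁ : List (ℕ × ℕ)) :
    ∀ (c₀ : List ℕ) (M : ℕ), (∀ x ∈ c₀, x ≤ M) →
      (l₁.foldl (fun c ab => mulLin ab.1 ab.2 c) c₀).length = c₀.length + l₁.length ∧
      ∀ y ∈ l₁.foldl (fun c ab => mulLin ab.1 ab.2 c) c₀,
        y ≤ (l₁.map fun ab : ℕ × ℕ => ab.1 + ab.2).prod * M := by
  induction l₁ with
  | nil => intro c₀ M h; simpa using h
  | cons f l ih =>
    intro c₀ M h
    rw [List.foldl_cons]
    obtain ⟨hlen, hbd⟩ := ih (mulLin f.1 f.2 c₀) ((f.1 + f.2) * M) (le_of_mem_mulLin h)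
    refine ⟨by rw [hlen, length_mulLin, List.length_cons]; omega, fun y hy => ?_⟩
    have := hbd y hy
    rw [List.map_cons, List.prod_cons]
    calc y ≤ (l.map fun ab : ℕ × ℕ => ab.1 + ab.2).prod * ((f.1 + f.2) * M) := this
      _ = (f.1 + f.2) * (l.map fun ab : ℕ × ℕ => ab.1 + ab.2).prod * M := by ring

/-- `size (∏ l) ≤ Σ size + 1`. [folklore] -/
private theorem size_list_prod_le (l : List ℕ) : Nat.size l.prod ≤ (l.map Nat.size).sum + 1 := by
  induction l with
  | nil => simp [Nat.size_one]
  | cons a l ih =>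
    rw [List.prod_cons, List.map_cons, List.sum_cons]
    have := size_mul_le a l.prod
    omega

/-- The sizes of the factors are paid for by the code of the factor list. [folklore] -/
private theorem sum_size_le_length_rawE (l : List (ℕ × ℕ)) :
    ((l.map fun ab : ℕ × ℕ => ab.1 + ab.2).map Nat.size).sum ≤ (rawE (pairE natE natE) l).length := by
  rw [length_rawE, List.map_map]
  refine List.sum_le_sum fun ab _ => ?_
  simp only [Function.comp_apply]
  rw [pairE_apply, length_boolPair, length_natE, length_natE]
  have := size_add_le ab.1 ab.2
  have := le_max_left (Nat.size ab.1) (Nat.size ab.2)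
  have := le_max_right (Nat.size ab.1) (Nat.size ab.2)
  omega

/-- A raw list of numerals of bounded size is short. [folklore] -/
private theorem length_rawE_natE_le {c : List ℕ} {K : ℕ} (h : ∀ y ∈ c, Nat.size y ≤ K) :
    (rawE natE c).length ≤ c.length * (2 * K + 2) := by
  rw [length_rawE]
  induction c with
  | nil => simp
  | cons y c ih =>
    rw [List.map_cons, List.sum_cons, List.length_cons]
    have hy := h y (List.mem_cons_self ..)
    have hc := ih fun z hz => h z (List.mem_cons_of_mem _ hz)
    rw [length_natE]
    nlinarith

/-- **Multiplication by a linear factor on codes**: `((a, b), c) ↦ mulLin a b c`.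
[cite: AroraBarak2009, §1.3] -/
theorem mulLinFP : CodeFP (pairE (pairE natE natE) (rawE natE)) (rawE natE)
    (fun p => mulLin p.1.1 p.1.2 p.2) := by
  let ctx : (ℕ × ℕ) × List ℕ → List Bool := pairE (pairE natE natE) (rawE natE)
  have hA : CodeFP ctx (rawE natE) (fun p => p.2.map (fun x => p.1.1 * x)) :=
    CodeFP.map (natMul.comp ((fst _ _).fst'.pair (snd _ _)))
  have hB : CodeFP ctx (rawE natE) (fun p => p.2.map (fun x => p.1.2 * x)) :=
    CodeFP.map (natMul.comp ((fst _ _).snd'.pair (snd _ _)))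
  have hA' : CodeFP ctx (rawE natE) (fun p => p.2.map (fun x => p.1.1 * x) ++ [0]) :=
    (rawAppend natE).comp (hA.pair (const _ [0]))
  have hB' : CodeFP ctx (rawE natE) (fun p => 0 :: p.2.map (fun x => p.1.2 * x)) :=
    (rawCons natE).comp ((const _ 0).pair hB)
  have hz := (zipWith (σ := (ℕ × ℕ) × List ℕ) (eσ := ctx) (g := fun q : ((ℕ × ℕ) × List ℕ) × ℕ × ℕ =>
    q.2.1 + q.2.2) (natAdd.comp (snd _ _))).comp ((CodeFP.id ctx).pair (hA'.pair hB'))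
  exact hz.congr fun p => rfl

/-- **The coefficient list of `∏ (a + bT)` on codes** (a fold of `mulLin`; the accumulator is
polynomially bounded: `|l₁| + 1` entries of size `≤ Σ size(a+b) + 1`). [cite: AroraBarak2009, §1.3 (polynomially bounded loops)] -/
theorem linProdFP : CodeFP (rawE (pairE natE natE)) (rawE natE) linProd := by
  have h := foldl₀ (step := fun (ab : ℕ × ℕ) (c : List ℕ) => mulLin ab.1 ab.2 c) (b₀ := [1])
    mulLinFP ((Polynomial.X + 1) * (2 * Polynomial.X + 4)) (fun l₁ l₂ => by
      set N := (rawE (pairE natE natE) (l₁ ++ l₂)).length with hN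
      obtain ⟨hlen, hbd⟩ := foldl_mulLin_bound l₁ [1] 1 (by simp)
      set c := l₁.foldl (fun c ab => mulLin ab.1 ab.2 c) [1] with hc
      have hN1 : l₁.length ≤ N :=
        (le_trans (by simp) (length_le_length_rawE (pairE natE natE) (l₁ ++ l₂)))
      have hS : ((l₁.map fun ab : ℕ × ℕ => ab.1 + ab.2).map Nat.size).sum ≤ N :=
        (sum_size_le_length_rawE l₁).trans
          (length_rawE_le_of_sublist _ (List.sublist_append_left l₁ l₂))
      have hsize : ∀ y ∈ c, Nat.size y ≤ N + 1 := fun y hy => by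
        have h1 := hbd y hy
        rw [mul_one] at h1
        exact (size_mono h1).trans ((size_list_prod_le _).trans (by omega))
      calc (rawE natE c).length ≤ c.length * (2 * (N + 1) + 2) := length_rawE_natE_le hsize
        _ ≤ (N + 1) * (2 * N + 4) := by
            rw [hlen, List.length_singleton]
            exact Nat.mul_le_mul (by omega) (by omega)
        _ = _ := by simp [Polynomial.eval_add, Polynomial.eval_mul])
  exact h.congr fun l => rfl

end CodeLin

/-! ### The program on codes, II: factors, values, rows, grids -/

section CodeProgram

open _root_.Computability

variable {σ : Type} {eσ : σ → List Bool}

/-- The index list `[(w, w % t, w / t) | w < m]` (variable `z_{v,i}` ↔ `w = i + t·v`). [cite: GuoKumarSaptharishiSolomon2019, proof of Thm 25 (arXiv p0013.txt:L14)] -/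
def idxList (t m : ℕ) : List (ℕ × (ℕ × ℕ)) := (List.range m).map fun w => (w, (w % t, w / t))

/-- Program form of `factors`: the replication count is capped by `B` (a no-op for `B > 0`,
needed to state the loop with a unary budget). [cite: GuoKumarSaptharishiSolomon2019, proof of Thm 25 (arXiv p0013.txt:L14-17)] -/
def factorsP (t m B : ℕ) (e l : List ℕ) : List (ℕ × ℕ) :=
  ((idxList t m).map fun x : ℕ × (ℕ × ℕ) =>
    List.replicate (min (digit B x.2.1 (e.getD x.2.2 0)) B) (l.getD x.1 0, l.getD (m + x.1) 0)).flatten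

/-- `factorsP = factors` for a positive base. [cite: GuoKumarSaptharishiSolomon2019, proof of Thm 25 (arXiv p0013.txt:L14-17)] -/
theorem factorsP_eq {t m B : ℕ} (hB : 0 < B) (e l : List ℕ) : factorsP t m B e l = factors t B m e l := by
  unfold factorsP factors idxList
  rw [List.map_map]
  congr 1
  refine List.map_congr_left fun w _ => ?_
  simp only [Function.comp_apply]
  rw [min_eq_left (digit_lt hB _ _).le]

/-- Program form of `valQ` (with `factorsP`; each summand as ONE fraction `(num·N)/den`).
[cite: GuoKumarSaptharishiSolomon2019, Def 9 and proof of Thm 25 (arXiv p0006.txt:L44-48, p0013.txt:L14-17)] -/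
def valQP (t m B : ℕ) (L : List (List ℕ × (ℤ × ℕ))) (l : List ℕ) (j : ℕ) : ℚ :=
  (L.map fun mono : List ℕ × (ℤ × ℕ) =>
    ((mono.2.1 * ((linProd (factorsP t m B mono.1 l)).getD j 0 : ℕ) : ℤ) : ℚ) / (mono.2.2 : ℚ)).sum

/-- `valQP = valQ` for a positive base. [cite: GuoKumarSaptharishiSolomon2019, proof of Thm 25 (arXiv p0013.txt:L14-17)] -/
theorem valQP_eq {t m B : ℕ} (hB : 0 < B) (L : List (List ℕ × (ℤ × ℕ))) (l : List ℕ) (j : ℕ) :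
    valQP t m B L l j = valQ t B m L l j := by
  unfold valQP valQ natCoeffs
  simp_rw [factorsP_eq hB]
  congr 1
  refine List.map_congr_left fun mono _ => ?_
  push_cast
  ring

/-- Program form of a row. [cite: GuoKumarSaptharishiSolomon2019, §3.2 (arXiv p0013.txt:L24-27)] -/
def rowMP (t m B : ℕ) (L : List (List ℕ × (ℤ × ℕ))) (s : ℕ) (l : List ℕ) : List ℚ :=
  (List.range s).map (valQP t m B L l)

/-- Base-`B` digits on codes (`B^i` through the unary `i`). [cite: AroraBarak2009, §1.3] -/
theorem digitFP {Bf xf i_f : σ → ℕ} (hB : CodeFP eσ natE Bf) (hi : CodeFP eσ unE i_f)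
    (hx : CodeFP eσ natE xf) : CodeFP eσ natE (fun s => digit (Bf s) (i_f s) (xf s)) :=
  (natMod.comp ((natDiv.comp (hx.pair (natPow.comp (hB.pair hi)))).pair hB)).congr fun _ => rfl

/-- The code of an index triple. [folklore] -/
private abbrev idxE : ℕ × (ℕ × ℕ) → List Bool := pairE natE (pairE unE natE)

/-- **The factor list on codes** (one replicated pair per variable `w < m`; context: `B` in binary
and unary, the exponent list `e` and the grid list `l`). [cite: AroraBarak2009, §1.3] -/
theorem factorsFP (t m : ℕ) {Bf : σ → ℕ} {ef lf : σ → List ℕ} (hB : CodeFP eσ natE Bf)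
    (huB : CodeFP eσ unE Bf) (he : CodeFP eσ (rawE natE) ef) (hl : CodeFP eσ (rawE natE) lf) :
    CodeFP eσ (rawE (pairE natE natE)) (fun s => factorsP t m (Bf s) (ef s) (lf s)) := by
  let ctx : σ × (ℕ × (ℕ × ℕ)) → List Bool := pairE eσ idxE
  have cs : CodeFP ctx eσ (fun c => c.1) := fst _ _
  have cw : CodeFP ctx natE (fun c => c.2.1) := (snd _ _).fst'
  have ci : CodeFP ctx unE (fun c => c.2.2.1) := (snd _ _).snd'.fst'
  have cv : CodeFP ctx natE (fun c => c.2.2.2) := (snd _ _).snd'.snd'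
  have cx : CodeFP ctx natE (fun c => (ef c.1).getD c.2.2.2 0) :=
    (rawGetD natE natE_zero).comp ((he.comp cs).pair cv)
  have cdig : CodeFP ctx natE (fun c => digit (Bf c.1) c.2.2.1 ((ef c.1).getD c.2.2.2 0)) :=
    digitFP (hB.comp cs) ci cx
  have ccount : CodeFP ctx unE (fun c => min (digit (Bf c.1) c.2.2.1 ((ef c.1).getD c.2.2.2 0)) (Bf c.1)) :=
    (unOfNatMin.comp ((huB.comp cs).pair cdig)).congr fun _ => rfl
  have ca : CodeFP ctx natE (fun c => (lf c.1).getD c.2.1 0) :=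
    (rawGetD natE natE_zero).comp ((hl.comp cs).pair cw)
  have cb : CodeFP ctx natE (fun c => (lf c.1).getD (m + c.2.1) 0) :=
    (rawGetD natE natE_zero).comp ((hl.comp cs).pair (natAdd.comp ((const _ m).pair cw)))
  have citem : CodeFP ctx (rawE (pairE natE natE)) (fun c =>
      List.replicate (min (digit (Bf c.1) c.2.2.1 ((ef c.1).getD c.2.2.2 0)) (Bf c.1))
        ((lf c.1).getD c.2.1 0, (lf c.1).getD (m + c.2.1) 0)) :=
    (replicateOf (pairE natE natE)).comp ((ca.pair cb).pair ccount)
  have h := (flatten (pairE natE natE)).comp ((CodeFP.map citem).comp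
    ((CodeFP.id eσ).pair (const eσ (idxList t m))))
  exact h.congr fun s => rfl

/-- The code of a dense monomial (exponent list, (numerator, denominator)). [cite: GuoKumarSaptharishiSolomon2019, Question 4 footnote (arXiv p0005.txt:L2)] -/
abbrev monoE : List ℕ × (ℤ × ℕ) → List Bool := pairE (listE natE) (pairE smE natE)

/-- **`Δ_j(Q)` at a grid point on codes**: the rational sum over the monomial list.
[cite: AroraBarak2009, §1.3] [cite: GuoKumarSaptharishiSolomon2019, §1.2 (arXiv p0006.txt:L28)] -/
theorem valQFP (t m : ℕ) {Bf jf : σ → ℕ} {Lf : σ → List (List ℕ × (ℤ × ℕ))} {lf : σ → List ℕ}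
    (hB : CodeFP eσ natE Bf) (huB : CodeFP eσ unE Bf) (hL : CodeFP eσ (rawE monoE) Lf)
    (hl : CodeFP eσ (rawE natE) lf) (hj : CodeFP eσ natE jf) :
    CodeFP eσ encodeRat (fun s => valQP t m (Bf s) (Lf s) (lf s) (jf s)) := by
  let ctx : σ × (List ℕ × (ℤ × ℕ)) → List Bool := pairE eσ monoE
  have cs : CodeFP ctx eσ (fun c => c.1) := fst _ _
  have ce : CodeFP ctx (rawE natE) (fun c => c.2.1) := (rawOfList natE).comp (snd _ _).fst'
  have cnum : CodeFP ctx intE (fun c => c.2.2.1) := intOfSM.comp (snd _ _).snd'.fst'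
  have cden : CodeFP ctx natE (fun c => c.2.2.2) := (snd _ _).snd'.snd'
  have cfac : CodeFP ctx (rawE (pairE natE natE)) (fun c => factorsP t m (Bf c.1) c.2.1 (lf c.1)) :=
    factorsFP t m (hB.comp cs) (huB.comp cs) ce (hl.comp cs)
  have cN : CodeFP ctx natE (fun c => (linProd (factorsP t m (Bf c.1) c.2.1 (lf c.1))).getD (jf c.1) 0) :=
    (rawGetD natE natE_zero).comp ((linProdFP.comp cfac).pair (hj.comp cs))
  -- (the remaining compositions are elaborated bottom-up, WITHOUT expected types: stating the
  -- intermediate functions makes the unifier time out on the `ℤ`/`ℚ` arithmetic heads)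
  have cz := intMul.comp (cnum.pair (intOfNat.comp cN))
  have citem := ratOfIntNat.comp (cz.pair cden)
  have h := ratSum.comp ((CodeFP.map citem).comp ((CodeFP.id eσ).pair hL))
  exact h.congr fun s => rfl

/-- **A row on codes** (`j` ranges over `[0, s)`, `s` given in unary and binary). [cite: AroraBarak2009, §1.3] -/
theorem rowFP (t m : ℕ) {Bf sf : σ → ℕ} {Lf : σ → List (List ℕ × (ℤ × ℕ))} {lf : σ → List ℕ}
    (hB : CodeFP eσ natE Bf) (huB : CodeFP eσ unE Bf) (hL : CodeFP eσ (rawE monoE) Lf)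
    (hl : CodeFP eσ (rawE natE) lf) (hus : CodeFP eσ unE sf) (hns : CodeFP eσ natE sf) :
    CodeFP eσ (rawE encodeRat) (fun s => rowMP t m (Bf s) (Lf s) (sf s) (lf s)) := by
  let ctx : σ × ℕ → List Bool := pairE eσ natE
  have cs : CodeFP ctx eσ (fun c => c.1) := fst _ _
  have citem : CodeFP ctx encodeRat (fun c => valQP t m (Bf c.1) (Lf c.1) (lf c.1) c.2) :=
    valQFP t m (hB.comp cs) (huB.comp cs) (hL.comp cs) (hl.comp cs) (snd _ _)
  have hrange : CodeFP eσ (rawE natE) (fun s => List.range (sf s)) :=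
    (rangeOf.comp (hus.pair hns)).congr fun s => by simp
  have h := (CodeFP.map citem).comp ((CodeFP.id eσ).pair hrange)
  exact h.congr fun s => rfl

/-- **The grid `{0..W-1}^n` on codes** (`W` in unary and binary). [cite: AroraBarak2009, §1.3] -/
theorem gridListsFP {Wf : σ → ℕ} (huW : CodeFP eσ unE Wf) (hW : CodeFP eσ natE Wf) :
    ∀ n : ℕ, CodeFP eσ (rawE (rawE natE)) (fun s => gridLists n (Wf s))
  | 0 => (const eσ [[]]).congr fun s => by simp [gridLists]
  | n + 1 => by
    have hrange : CodeFP eσ (rawE natE) (fun s => List.range (Wf s)) :=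
      (rangeOf.comp (huW.pair hW)).congr fun s => by simp
    have h := (map₀ (rawCons natE)).comp ((rawProduct natE (rawE natE)).comp
      (hrange.pair (gridListsFP huW hW n)))
    exact h.congr fun s => by simp [gridLists]

end CodeProgram

/-! ### The program on codes, III: the parameters as functions of the unary input `s` -/

section CodeParams

open _root_.Computability

/-- `2^{β(s)} ≤ 2^E (s+1)^E` for every `s` (the unary budget for `B`). [cite: GuoKumarSaptharishiSolomon2019, proof of Thm 25 (arXiv p0013.txt:L12-17)] -/
theorem two_pow_beta_le_succ (E s : ℕ) : 2 ^ beta E s ≤ 2 ^ E * (s + 1) ^ E := by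
  rw [beta, mul_comm E, pow_mul, ← mul_pow]
  apply Nat.pow_le_pow_left
  rw [pow_succ']
  refine Nat.mul_le_mul_left 2 ?_
  rcases Nat.eq_zero_or_pos s with rfl | hs
  · simp
  · exact (Nat.pow_log_le_self 2 hs.ne').trans (Nat.le_succ s)

/-- `⌊log₂ s⌋` from the unary `s`. [cite: AroraBarak2009, §1.3] -/
theorem logFP : CodeFP unE natE (fun s => Nat.log 2 s) :=
  (natLog2Min.comp (natOfUn.pair replicateUnit)).congr fun s => by
    simp [min_eq_right (Nat.log_le_self 2 s)]

/-- `β(s)` in binary. [cite: AroraBarak2009, §1.3] -/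
theorem betaFP (E : ℕ) : CodeFP unE natE (beta E) :=
  (natMul.comp ((const _ E).pair (natAdd.comp (logFP.pair (const _ 1))))).congr fun _ => rfl

/-- `c · u` in unary for a constant `c`. [folklore] -/
private theorem unConstMulFP (c : ℕ) {g : ℕ → ℕ} (hg : CodeFP unE unE g) :
    CodeFP unE unE (fun s => c * g s) :=
  ((ulength unitE).comp (unitsMul.comp ((const _ (List.replicate c ())).pair
    (replicateUnit.comp hg)))).congr fun s => by simp

/-- `β(s)` in unary (capped conversion with the budget `E (s + 1) ≥ β(s)`). [cite: AroraBarak2009, §1.3] -/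
theorem ubetaFP (E : ℕ) : CodeFP unE unE (beta E) := by
  have hbud : CodeFP unE unE (fun s => E * (s + 1)) := unConstMulFP E unSucc
  exact (unOfNatMin.comp (hbud.pair (betaFP E))).congr fun s => min_eq_left (beta_le E s)

/-- `B(s) = 2^{β(s)}` in binary. [cite: AroraBarak2009, §1.3] -/
theorem baseFP (E : ℕ) : CodeFP unE natE (fun s => 2 ^ beta E s) :=
  (natPow.comp ((const _ 2).pair (ubetaFP E))).congr fun _ => rfl

/-- `B(s)` in unary (capped conversion with the budget `2^E (s+1)^E ≥ B(s)`). [cite: AroraBarak2009, §1.3] -/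
theorem ubaseFP (E : ℕ) : CodeFP unE unE (fun s => 2 ^ beta E s) := by
  have hbud : CodeFP unE unE (fun s => 2 ^ E * (s + 1) ^ E) :=
    ((ulength unitE).comp (unitsMul.comp ((const _ (List.replicate (2 ^ E) ())).pair
      ((unitsPow E).comp unSucc)))).congr fun s => by simp
  exact (unOfNatMin.comp (hbud.pair (baseFP E))).congr fun s => min_eq_left (two_pow_beta_le_succ E s)

/-- `d(s) = s^{tE}` in unary. [cite: AroraBarak2009, §1.3] -/
theorem udOfFP (t E : ℕ) : CodeFP unE unE (dOf t E) :=
  ((ulength unitE).comp (unitsPow (t * E))).congr fun s => by simp [dOf]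

/-- `W(s)` in unary. [cite: AroraBarak2009, §1.3] -/
theorem uWOfFP (k t E : ℕ) : CodeFP unE unE (WOf k t E) := by
  have h1 : CodeFP unE unE (fun s => k * t * 2 ^ beta E s) := unConstMulFP (k * t) (ubaseFP E)
  have h2 : CodeFP unE unE (fun s => s * (k * t * 2 ^ beta E s)) :=
    ((ulength unitE).comp (unitsMul.comp (replicateUnit.pair (replicateUnit.comp h1)))).congr
      fun s => by simp
  exact (unSucc.comp h2).congr fun s => rfl

/-- `monomialListEncoding` codes by `listE monoE`. [cite: GuoKumarSaptharishiSolomon2019, Question 4 footnote (arXiv p0005.txt:L2)] -/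
theorem monomialListEncoding_eq :
    (monomialListEncoding.encode : List (List ℕ × (ℤ × ℕ)) → List Bool) = listE monoE := by
  unfold monomialListEncoding monoE smE
  rw [listE_eq, pairE_eq, listE_eq, pairE_eq, natE_eq]

/-- `encodePoints` codes by `listE (listE encodeRat)`. [cite: GuoKumarSaptharishiSolomon2019, §1 (arXiv p0003.txt:L38)] -/
theorem encodePoints_eq (H : List (List ℚ)) : encodePoints H = listE (listE encodeRat) H := by
  unfold encodePoints
  rw [listE_eq, listE_eq, pairE_eq, natE_eq]
  have hq : ∀ q : ℚ, pairE encodingIntBool.encode natE (q.num, q.den) = encodeRat q := fun q => by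
    rw [encodeRat_eq_pairE]; rfl
  simp only [listE, rawE, List.map_map, List.length_map, Function.comp_def, hq]
  rfl

/-- An explicit family is a `CodeFP` map `d ↦ denseList (P d)` from unary to monomial lists.
[cite: GuoKumarSaptharishiSolomon2019, Question 4 footnote (arXiv p0005.txt:L2)] -/
theorem codeFP_of_isExplicitFamily {k : ℕ} {P : ℕ → MvPolynomial (Fin k) ℚ}
    (hP : IsExplicitFamily (k := fun _ => k) P) : CodeFP unE (listE monoE) (fun d => denseList (P d)) := by
  obtain ⟨g, hg, hgP⟩ := hP
  exact ⟨g, hg, fun d => by rw [hgP, monomialListEncoding_eq]⟩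

end CodeParams

/-! ### Assembly: the hitting-set family is explicit; the discharge of ‹Thm 5› -/

section Assembly

open _root_.Computability

variable {k : ℕ}

/-- Program form of `mainList`. [cite: GuoKumarSaptharishiSolomon2019, §3.2 (arXiv p0013.txt:L24-27)] -/
def mainMP (P : ℕ → MvPolynomial (Fin k) ℚ) (t E s : ℕ) : List (List ℚ) :=
  (gridLists (k * t + k * t) (WOf k t E s)).map
    (rowMP t (k * t) (2 ^ beta E s) (denseList (P (dOf t E s))) s)

/-- The program computes `mainList`. [cite: GuoKumarSaptharishiSolomon2019, §3.2 (arXiv p0013.txt:L24-27)] -/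
theorem mainMP_eq (P : ℕ → MvPolynomial (Fin k) ℚ) (t E s : ℕ) : mainMP P t E s = mainList P t E s := by
  unfold mainMP mainList gridImage Qof
  refine List.map_congr_left fun l _ => ?_
  rw [← rowM_eq]
  unfold rowMP rowM
  refine List.map_congr_left fun j _ => ?_
  exact valQP_eq (Nat.two_pow_pos _) _ _ _

/-- Program form of `hitList`. [cite: GuoKumarSaptharishiSolomon2019, Thm 5 (arXiv p0005.txt:L28-31)] -/
def hitMP (P : ℕ → MvPolynomial (Fin k) ℚ) (t E s₀ s : ℕ) : List (List ℚ) :=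
  if s < s₀ then smallList s else mainMP P t E s

/-- The program computes `hitList`. [cite: GuoKumarSaptharishiSolomon2019, Thm 5 (arXiv p0005.txt:L28-31)] -/
theorem hitMP_eq (P : ℕ → MvPolynomial (Fin k) ℚ) (t E s₀ : ℕ) : hitMP P t E s₀ = hitList P t E s₀ := by
  funext s
  unfold hitMP hitList
  rw [mainMP_eq]

/-- **The generator grid on codes**: `1^s ↦ mainList s` is computed by a polynomial-time string
function. [cite: GuoKumarSaptharishiSolomon2019, §1.2 (arXiv p0006.txt:L28) and proof of Thm 25 (p0013.txt:L24-31)] [cite: AroraBarak2009, §1.3] -/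
theorem mainFP (P : ℕ → MvPolynomial (Fin k) ℚ) (t E : ℕ) (hP : IsExplicitFamily (k := fun _ => k) P) :
    CodeFP unE (rawE (rawE encodeRat)) (mainMP P t E) := by
  have hfam := codeFP_of_isExplicitFamily hP
  have hL : CodeFP unE (rawE monoE) (fun s => denseList (P (dOf t E s))) :=
    (rawOfList monoE).comp (hfam.comp (udOfFP t E))
  have huW := uWOfFP k t E
  have hW : CodeFP unE natE (WOf k t E) := natOfUn.comp huW
  have hgrid := gridListsFP huW hW (k * t + k * t)
  let ctx : ℕ × List ℕ → List Bool := pairE unE (rawE natE)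
  have cs : CodeFP ctx unE (fun c => c.1) := fst _ _
  have crow := rowFP t (k * t) ((baseFP E).comp cs) ((ubaseFP E).comp cs) (hL.comp cs) (snd _ _) cs
    (natOfUn.comp cs)
  have h := (CodeFP.map crow).comp ((CodeFP.id unE).pair hgrid)
  exact h.congr fun s => rfl

/-- **The hitting-set family on codes** (table below the threshold, generator grid above), in the
headed list format of `encodePoints`. [cite: GuoKumarSaptharishiSolomon2019, §1.2 (arXiv p0006.txt:L28)] [cite: AroraBarak2009, §1.3] -/
theorem hitFP (P : ℕ → MvPolynomial (Fin k) ℚ) (t E s₀ : ℕ) (hP : IsExplicitFamily (k := fun _ => k) P) :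
    CodeFP unE (listE (listE encodeRat)) (hitMP P t E s₀) := by
  have hmain : CodeFP unE (listE (listE encodeRat)) (mainMP P t E) :=
    ((listOfRaw (listE encodeRat)).comp ((map₀ (listOfRaw encodeRat)).comp (mainFP P t E hP))).congr
      fun s => by simp
  have htest : CodeFP unE bitE (fun s => decide (s < s₀)) := natLt.comp (natOfUn.pair (const _ s₀))
  have hsmall : CodeFP unE (listE (listE encodeRat))
      (fun s => if s ∈ List.range s₀ then smallList s else []) :=
    ofList unE_injective _ smallList [] (List.range s₀)
  refine (htest.ite hsmall hmain).congr fun s => ?_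
  unfold hitMP
  by_cases h : s < s₀
  · simp [h, List.mem_range]
  · simp [h]

/-- **Explicitness of the hitting sets of ‹Thm 5›**: an `FP` string function maps `1^s` to the
encoded point list `encodePoints (hitList … s)`. [cite: GuoKumarSaptharishiSolomon2019, Thm 5 with §1.2 (arXiv p0005.txt:L28-31, p0006.txt:L28)] -/
theorem isExplicitPoints_hitList (P : ℕ → MvPolynomial (Fin k) ℚ) (t E s₀ : ℕ)
    (hP : IsExplicitFamily (k := fun _ => k) P) : IsExplicitPoints (hitList P t E s₀) := by
  obtain ⟨f, hf, hfH⟩ := hitFP P t E s₀ hP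
  refine ⟨f, hf, fun s => ?_⟩
  show f (unE s) = _
  rw [hfH, encodePoints_eq, hitMP_eq]

end Assembly

end GKSS2019

/-! ### The discharge -/

open GKSS2019 HittingSets Literature.Barriers.ValiantsHypothesis in
/-- **GKSS ‹Thm 5› holds (typed form `GKSS2019_thm_5`, over `ℚ`).** From the tree's proof of the
main theorem (`GKSS2019_mainThm_holds`, ‹G_P is an HSG›): split `P_{k,d(s),t}` into `Q(s)`
(`GKSS19KroneckerSplitting`), transfer the hardness and apply the main theorem
(`isGeneratorFor_Qof`), evaluate `G_{Q(s)}` on a grid (`hitList_hits`, `length_hitList_le`), and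
enumerate the grid image in polynomial time (`isExplicitPoints_hitList`).
[cite: GuoKumarSaptharishiSolomon2019, Thm 5 (arXiv p0005.txt:L28-31), proof §3.2 (p0013.txt:L10-36)] -/
theorem GKSS2019_thm_5_holds : GKSS2019_thm_5 := by
  intro k δ hk hδ P hP hdeg hhard
  obtain ⟨c, hc⟩ := GKSS2019_mainThm_holds
  obtain ⟨s₁, hs₁, hgen⟩ := isGeneratorFor_Qof hk hδ hc P hdeg hhard
  exact ⟨hitList P (tOf c δ) (EOf k (tOf c δ)) s₁, isExplicitPoints_hitList P _ _ _ hP,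
    length_hitList_le P _ _ hs₁, fun s => hitList_hits (le_trans one_le_two hs₁) hgen s⟩

end Literature.Computability.AlgebraicComplexity

end
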